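import Literature.MathematicalPhysics.QuantumFieldTheory.BalabanImbrieJaffe1984to88.BIJ85Sect4Statements
import Literature.MathematicalPhysics.QuantumFieldTheory.Balaban1983to89.LatticeFieldCalculus

/-!
# `BalabanImbrieJaffe1984to88.BIJ88Sect2Statements` — T. Bałaban, J. Imbrie, A. Jaffe, *Effective action and cluster
properties of the abelian Higgs model*, Commun. Math. Phys. **114** (1988) 257–315 [BalabanImbrieJaffe1988]:
Sect. 2 "Localized Kernels", displays (2.1)–(2.49) — the running couplings `e_k`, `λ_k` (2.2), the localization lengths
`r(e_k)` (2.3), `p(e_k)` (2.33), the cutoffs `ζ_k`, `ζ′_k`, `ζ″_k` (2.1), (2.24), (2.29), the localized kernels `H_{k,loc}`,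
`C^{(k)}_{loc}`, `𝒟_{k,loc}`, `σ_{k,loc}`, `C_{k,loc}`, `G_{k,loc}`, `Δ_{k,loc}`, `C^{(k)}_Λ` and their printed bounds.

statement-level skeleton of published theorems with citation tags; proofs where landed; nothing here is a claim about the Yang–Mills mass gap

PDF held: `paper:balaban1988-cmp114-bij-abelian-higgs-effective-action` (journal page = PDF page + 256).  Renders read as
images (poppler, ×3): PDF pp. 4–9 (journal 260–265).

CITATION HEADER (lean-in-tree rule).  Part of the lit-balaban TYPED SKELETON (HOME `run/shared/lean/pub/lit-balaban/`; rows
`C2.Eq2.1` … `C2.Eq2.49` of `HOME/lit-balaban-r18/ROWS-C2.md`; unit `lit-balaban-r18`).  WHAT IS REPRODUCED, and how.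
(a) DEFINITIONS WITH BODIES: the scales (2.2), (2.3), (2.33) as real functions; the localization `K_loc = ζK` (2.4)/(2.25)/(2.28),
the sharp truncations (2.8)/(2.14), the convex combination (2.27) over ABSTRACT kernel carriers (index types with a distance
function — the lattices `T_η`, `T^{(k)}_1`, `T^{(k)}_{0,1}` and the operators `H_k`, `C^{(k)}`, `σ_k`, `G_k(Ω,u)` of [2] =
[BalabanImbrieJaffe1985] are the instance's); the operator identities (2.9), (2.12), (2.15), (2.20)–(2.22), (2.34), (2.39)–(2.40)
in a ring of operators, REUSING `BIJ85Sect4Statements.curlyD` ((2.12) = the localized [I] (4.4.4)) and `…deltaScalar` ((2.34) =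
the localized [I] (4.6.4)); the smoothness condition (2.32) and the lower bound (2.38) CONCRETELY on the tori of
`Balaban1983to89.Setup` with `LatticeFieldCalculus.grad/curl/diverg`.  (b) PROVED (kernel-checked elementary cores): (2.6) from
(2.1)+(2.4) (`loc_vanishes`), the mechanism of (2.7) with explicit constants (`loc_close`), (2.10) from (2.9) given the averaging
identities `QQ^{s*} = I = Q^sQ^*` (`eq210_of`), `e_k²/λ_k = e²/λ` behind p. 266 (`eK_sq_div_lamK`), (2.37)-type support of a
truncation (`trunc_vanishes`).  (c) STATEMENTS as `def … : Prop`, verbatim, constants explicit: (2.5)–(2.7), (2.10)–(2.11), (2.13),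
(2.16)–(2.19), (2.23), (2.26), (2.30)–(2.31), (2.35)–(2.37), (2.41), (2.45)–(2.47), (2.49).  Attributions printed with the displays
((2.5) "see (I.7.2.2)", (2.15) "(I.5.2.6)", (2.21) "(I.5.1.1)", (2.23) "(I.7.2.4)", (2.30) "random walk expansion of [6]" =
[Balaban1983RegularityDecay], (2.38) "(I.7.3.2)") are DEPGRAPH edges, not Lean hypotheses.  NOTHING of the paper is asserted beyond
the kernel-checked items under (b).
-/

namespace Literature.MathematicalPhysics.QuantumFieldTheory.BalabanImbrieJaffe1984to88.BIJ88Sect2Statements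

open scoped BigOperators
open Finset

noncomputable section

/-! ## Scales (2.2), (2.3), (2.33) -/

/-- **(2.2)** p. 260 [PDF 4], verbatim: *"Here b ∈ T_η, b′ ∈ T₁^{(k)}, and e_k = (L^kε)^{(4−d)/2}e, λ_k = (L^kε)^{4−d}λ, (2.2)"* —
the running charge. [cite: BalabanImbrieJaffe1988, (2.2) p.260] -/
def eK (L ε e : ℝ) (d k : ℕ) : ℝ := (L ^ k * ε) ^ ((4 - (d : ℝ)) / 2) * e

/-- **(2.2)**, the running quartic coupling `λ_k = (L^kε)^{4−d}λ` (= **(3.9)** p. 266). [cite: BalabanImbrieJaffe1988, (2.2) p.260] -/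
def lamK (L ε lam : ℝ) (d k : ℕ) : ℝ := (L ^ k * ε) ^ (4 - (d : ℝ)) * lam

/-- kernel, p. 266 [PDF 10]: *"since e²/λ = O(1) we have also e_k²/λ_k = O(1), by (2.2)"* — in fact `e_k²/λ_k = e²/λ` exactly.
[cite: BalabanImbrieJaffe1988, (3.9) p.266] -/
theorem eK_sq_div_lamK {L ε : ℝ} (hL : 0 < L) (hε : 0 < ε) (e lam : ℝ) (d k : ℕ) :
    eK L ε e d k ^ 2 / lamK L ε lam d k = e ^ 2 / lam := by
  have hx : 0 < L ^ k * ε := mul_pos (pow_pos hL k) hε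
  have h2 : ((L ^ k * ε) ^ ((4 - (d : ℝ)) / 2)) ^ 2 = (L ^ k * ε) ^ (4 - (d : ℝ)) := by
    rw [← Real.rpow_natCast, ← Real.rpow_mul hx.le]; norm_num
  have hne : (L ^ k * ε) ^ (4 - (d : ℝ)) ≠ 0 := (Real.rpow_pos_of_pos hx _).ne'
  unfold eK lamK
  rw [mul_pow, h2, mul_div_mul_left _ _ hne]

/-- **(2.3)** p. 260 [PDF 4], verbatim: *"r(e_k) = |log e_k⁻¹|^r, r > 1. (2.3)"* — the localization length as a function of the
exponent `r` and of `e_k`. [cite: BalabanImbrieJaffe1988, (2.3) p.260] -/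
def rLen (r ek : ℝ) : ℝ := |Real.log ek⁻¹| ^ r

/-- **(2.33)** p. 263 [PDF 7], verbatim: *"Here p(e_k) = |log e_k⁻¹|^p, p = O(1) (2.33) is our logarithmic scale for small fields."*
[cite: BalabanImbrieJaffe1988, (2.33) p.263] -/
def pLog (p ek : ℝ) : ℝ := |Real.log ek⁻¹| ^ p

/-! ## Cutoffs and localized kernels: (2.1), (2.4), (2.8), (2.14), (2.24)–(2.25), (2.27)–(2.29) -/

variable {α β : Type*}

/-- A localization function with the printed two thresholds: `ζ = 1` within distance `R₁`, `ζ = 0` beyond distance `R₀` (the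
common shape of (2.1), (2.24), (2.29); smoothness in between is the instance's). [cite: BalabanImbrieJaffe1988, (2.1) p.260] -/
def IsCutoff (dist : α → β → ℝ) (ζ : α → β → ℝ) (R₁ R₀ : ℝ) : Prop :=
  (∀ a b, dist a b ≤ R₁ → ζ a b = 1) ∧ ∀ a b, R₀ ≤ dist a b → ζ a b = 0

/-- **(2.1)** p. 260 [PDF 4], verbatim: *"Construct a translation invariant localization function ζ_k such that ζ_k(b,b′) = 0, if
dist(b,b′) ≧ ⅛r(e_k), 1, if dist(b,b′) ≦ (1/16)r(e_k), (2.1) and such that ζ_k is a smooth function of b. Here b ∈ T_η, b′ ∈ T₁^{(k)}"*.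
[cite: BalabanImbrieJaffe1988, (2.1) p.260] -/
def Zeta21 (dist : α → β → ℝ) (rek : ℝ) (ζ : α → β → ℝ) : Prop := IsCutoff dist ζ (rek / 16) (rek / 8)

/-- **(2.24)** p. 262 [PDF 6], verbatim: *"The localized version of C_k is defined using another smooth cutoff: ζ′_k(x,b′) = 1, for
dist(x,b′) ≦ ¼r(e_k), 0, for dist(x,b′) ≧ ½r(e_k). (2.24)"* [cite: BalabanImbrieJaffe1988, (2.24) p.262] -/
def Zeta224 (dist : α → β → ℝ) (rek : ℝ) (ζ' : α → β → ℝ) : Prop := IsCutoff dist ζ' (rek / 4) (rek / 2)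

/-- **(2.29)** p. 263 [PDF 7], verbatim: *"where ζ″_k(x₁,x₂) is a smooth function of x₁ − x₂, ζ″_k(x₁,x₂) = 0, if |x₁ − x₂| ≧ (1/4L)
r(e_{k−1}), 1, if |x₁ − x₂| ≦ (1/8L) r(e_{k−1}). (2.29)"* (`rekm1` = r(e_{k−1})). [cite: BalabanImbrieJaffe1988, (2.29) p.263] -/
def Zeta229 (dist : α → α → ℝ) (L rekm1 : ℝ) (ζ'' : α → α → ℝ) : Prop :=
  IsCutoff dist ζ'' (rekm1 / (8 * L)) (rekm1 / (4 * L))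

/-- **(2.4)** p. 260 [PDF 4], verbatim: *"Then the localized version of H_k has a kernel H_{k,loc}(b,b′) = ζ_k(b,b′)H_k(b,b′). (2.4)"* —
also **(2.25)** `C_{k,loc}(x,b′) = ζ′_k(x,b′)C_k(x,b′)` and **(2.28)** `G_{k,loc}(u;x₁,x₂) = ζ″_k(x₁,x₂)G̃_k(u;x₁,x₂)`: pointwise
product of a cutoff and a kernel. [cite: BalabanImbrieJaffe1988, (2.4) p.260] -/
def loc (ζ K : α → β → ℝ) : α → β → ℝ := fun a b => ζ a b * K a b

/-- **(2.8)** p. 261 [PDF 5], verbatim: *"First define C̃^{(k)}(b₁,b₂) = C^{(k)}(b₁,b₂), if dist(b₁,b₂) ≦ ¼r(e_k), 0, otherwise, (2.8)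
and extend by translation invariance to T₁^{(k)}"* — also **(2.14)** p. 261 `σ_{k,loc}(p₁,p₂) = σ_k(p₁,p₂)` if
`dist(p₁,p₂) ≦ (1/2L) r(e_{k−1})`, `0` otherwise: sharp truncation of a kernel at radius `R`. [cite: BalabanImbrieJaffe1988, (2.8) p.261] -/
def trunc (dist : α → β → ℝ) (R : ℝ) (K : α → β → ℝ) : α → β → ℝ := fun a b => if dist a b ≤ R then K a b else 0

/-- **(2.27)** p. 263 [PDF 7], verbatim: *"Let {□_α} be the collection of (1/2L) r(e_{k−1})-cubes that can be built from cubes of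
size M = O(1) as in [6]. Define G̃_k(u;x₁,x₂) = Σ_α λ_αG_k(□_α,u;x₁,x₂) (2.27) as a convex combination of Neumann propagators. The
convex combination varies smoothly with (x₁+x₂)/2"* — weights `w i x₁ x₂ = λ_α`. [cite: BalabanImbrieJaffe1988, (2.27) p.263] -/
def convexComb {ι : Type*} [Fintype ι] (w : ι → α → α → ℝ) (G : ι → α → α → ℝ) : α → α → ℝ :=
  fun x₁ x₂ => ∑ i, w i x₁ x₂ * G i x₁ x₂

/-- (2.27): the weights form a convex combination at every pair of points. [cite: BalabanImbrieJaffe1988, (2.27) p.263] -/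
def IsConvexWeights {ι : Type*} [Fintype ι] (w : ι → α → α → ℝ) : Prop :=
  (∀ i x₁ x₂, 0 ≤ w i x₁ x₂) ∧ ∀ x₁ x₂, ∑ i, w i x₁ x₂ = 1

/-! ## Printed kernel bounds as statements -/

/-- Exponential decay of a kernel, `|K(a,b)| ≦ c e^{−c dist(a,b)}` for all a, b: **(2.5)** p. 260 (H_{k,loc}), **(2.36)** p. 263
(Δ_{k,loc}), **(2.41)** p. 264 (C^{(k)}_Λ(u)). [cite: BalabanImbrieJaffe1988, (2.5) p.260] -/
def Decay (dist : α → β → ℝ) (K : α → β → ℝ) (c : ℝ) : Prop :=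
  ∀ a b, |K a b| ≤ c * Real.exp (-c * dist a b)

/-- Exponential decay beyond a threshold: **(2.16)** p. 261, verbatim *"|σ_k(p₁,p₂)| ≦ ce^{−c dist(p₁,p₂)} for dist(p₁,p₂) ≧ c.
(2.16)"*, **(2.23)** p. 262 *"|C_k(x,b′)| ≦ ce^{−c dist(x,b′)}, dist(x,b′) > c. (2.23)"* (typed with `≤` on the threshold; (2.23)
prints `>`). [cite: BalabanImbrieJaffe1988, (2.16) p.261] -/
def DecayFar (dist : α → β → ℝ) (K : α → β → ℝ) (c : ℝ) : Prop :=
  ∀ a b, c ≤ dist a b → |K a b| ≤ c * Real.exp (-c * dist a b)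

/-- Finite range: `K(a,b) = 0` for `dist(a,b) ≧ R` — **(2.6)** p. 260 (H_{k,loc}, R = ⅛r(e_k)), p. 261 (𝒟_{k,loc}, R = ½r(e_k)),
**(2.37)** p. 263 (Δ_{k,loc}, R = (1/2L) r(e_{k−1})). [cite: BalabanImbrieJaffe1988, (2.6) p.260] -/
def Vanishes (dist : α → β → ℝ) (K : α → β → ℝ) (R : ℝ) : Prop :=
  ∀ a b, R ≤ dist a b → K a b = 0

/-- Closeness of a localized kernel to the exact one, `|K_loc(a,b) − K(a,b)| ≦ δ e^{−c dist(a,b)}`: **(2.7)** p. 260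
(δ = e^{−cr(e_k)}), **(2.18)** p. 262 (δ = ce^{−cr(e_k)}), **(2.26)** p. 262, **(2.47)** p. 265 (δ = e^{−cr(e_k)}); (2.35) carries a
region condition (`Close235`). [cite: BalabanImbrieJaffe1988, (2.7) p.260] -/
def Close (dist : α → β → ℝ) (Kloc K : α → β → ℝ) (δ c : ℝ) : Prop :=
  ∀ a b, |Kloc a b - K a b| ≤ δ * Real.exp (-c * dist a b)

/-- kernel: **(2.6)** follows from (2.1) and (2.4) — a cutoff vanishing beyond `R₀` kills the localized kernel there.
[cite: BalabanImbrieJaffe1988, (2.6) p.260] -/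
theorem loc_vanishes {dist : α → β → ℝ} {ζ : α → β → ℝ} {R₁ R₀ : ℝ} (hζ : IsCutoff dist ζ R₁ R₀) (K : α → β → ℝ) :
    Vanishes dist (loc ζ K) R₀ := by
  intro a b hab
  simp [loc, hζ.2 a b hab]

/-- kernel: the support of a sharp truncation (the shape of (2.37) and of "𝒟_{k,loc}(b₁,b₂) = 0 for dist ≧ ½r(e_k)").
[cite: BalabanImbrieJaffe1988, (2.8) p.261] -/
theorem trunc_vanishes (dist : α → β → ℝ) (R R' : ℝ) (hR : R < R') (K : α → β → ℝ) : Vanishes dist (trunc dist R K) R' := by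
  intro a b hab
  have : ¬ dist a b ≤ R := by linarith
  simp [trunc, this]

/-- kernel: the MECHANISM of **(2.7)** with explicit constants — if `0 ≤ ζ ≤ 1`, `ζ = 1` within `R₁`, and `|K| ≦ ce^{−c dist}` with
`c ≥ 0`, then `|ζK − K| ≦ (c e^{−(c/2)R₁}) e^{−(c/2) dist}` (the paper absorbs the prefactor into `e^{−cr(e_k)}`, `R₁ = r(e_k)/16`).
[cite: BalabanImbrieJaffe1988, (2.7) p.260] -/
theorem loc_close {dist : α → β → ℝ} {ζ K : α → β → ℝ} {R₁ R₀ c : ℝ} (hc : 0 ≤ c) (hζ : IsCutoff dist ζ R₁ R₀)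
    (h01 : ∀ a b, 0 ≤ ζ a b ∧ ζ a b ≤ 1) (hK : Decay dist K c) :
    Close dist (loc ζ K) K (c * Real.exp (-(c / 2) * R₁)) (c / 2) := by
  intro a b
  by_cases hab : dist a b ≤ R₁
  · have h1 := hζ.1 a b hab
    simp only [loc, h1, one_mul, sub_self, abs_zero]
    positivity
  · rw [not_le] at hab
    have hfac : |loc ζ K a b - K a b| ≤ |K a b| := by
      have : loc ζ K a b - K a b = (ζ a b - 1) * K a b := by simp only [loc]; ring
      rw [this, abs_mul]
      have hz : |ζ a b - 1| ≤ 1 := by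
        rw [abs_le]; constructor <;> linarith [(h01 a b).1, (h01 a b).2]
      calc |ζ a b - 1| * |K a b| ≤ 1 * |K a b| := by gcongr
        _ = |K a b| := one_mul _
    refine hfac.trans ((hK a b).trans ?_)
    rw [mul_assoc, ← Real.exp_add]
    gcongr
    nlinarith

/-- **(2.9)** p. 261 [PDF 5], verbatim: *"Then put C^{(k)}_{loc} = (I − Q^{s*}Q)C̃^{(k)}(I − Q*Q^s); (2.9)"* — in a ring of operators on
bond functions (`Qst` = Q*, `Qs` = Q^s, `Qsst` = Q^{s*}; *"See [2, Chap. 2] for definitions of the block averaging operators Q, Q^s,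
and Q^e"*). [cite: BalabanImbrieJaffe1988, (2.9) p.261] -/
def cLoc {R : Type*} [Ring R] (Q Qst Qs Qsst Ct : R) : R := (1 - Qsst * Q) * Ct * (1 - Qst * Qs)

/-- **(2.10)** p. 261 [PDF 5], verbatim: *"this insures that C^{(k)}_{loc}, like C^{(k)}, satisfies the constraints from the
renormalization transformation and from the axial gauge conditions: QC^{(k)}_{loc} = C^{(k)}_{loc}Q* = 0, (2.10)"*.
[cite: BalabanImbrieJaffe1988, (2.10) p.261] -/
def Eq210 {R : Type*} [Ring R] (Q Qst Cl : R) : Prop := Q * Cl = 0 ∧ Cl * Qst = 0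

/-- kernel: the algebra by which (2.9) "insures" (2.10): if `QQ^{s*} = I` and `Q^sQ* = I` then `QC_loc = 0 = C_locQ*`.
[cite: BalabanImbrieJaffe1988, (2.10) p.261] -/
theorem eq210_of {R : Type*} [Ring R] (Q Qst Qs Qsst Ct : R) (h1 : Q * Qsst = 1) (h2 : Qs * Qst = 1) :
    Eq210 Q Qst (cLoc Q Qst Qs Qsst Ct) := by
  constructor
  · have : Q * (1 - Qsst * Q) = 0 := by rw [mul_sub, mul_one, ← mul_assoc, h1, one_mul, sub_self]
    simp only [cLoc, ← mul_assoc, this, zero_mul]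
  · have : (1 - Qst * Qs) * Qst = 0 := by rw [sub_mul, one_mul, mul_assoc, h2, mul_one, sub_self]
    simp only [cLoc, mul_assoc, this, mul_zero]

/-- **(2.11)** p. 261 [PDF 5], verbatim: *"Σ_{b∈Γ_{y,x}} C^{(k)}_{loc}(b,b₀) = Σ_{b∈Γ_{y,x}} C^{(k)}_{loc}(b₀,b) = 0. (2.11)"* — over the
family of axial-gauge contours `Γ_{y,x}` (finite sets of bonds, indexed by `ι`). [cite: BalabanImbrieJaffe1988, (2.11) p.261] -/
def Eq211 {ι : Type*} (Γ : ι → Finset β) (Cl : β → β → ℝ) : Prop :=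
  ∀ i b₀, ∑ b ∈ Γ i, Cl b b₀ = 0 ∧ ∑ b ∈ Γ i, Cl b₀ b = 0

/-- **(2.12)** p. 261 [PDF 5], verbatim: *"From C^{(k)}_{loc} and H_{k,loc} we construct a localized η-lattice gauge field propagator
analogous to 𝒟_k: 𝒟_{k,loc} = Σ_{j=0}^{k−1} H^{L^jη}_{j,loc}C^{(j),L^jη}_{loc}H^{*L^j}_{j,loc} ≡ Σ_{j=0}^{k−1} G^{(j),η}_{loc}. (2.12)"* —
the finite sum `BIJ85Sect4Statements.curlyD` of [I] (4.4.4) applied to the localized sequences. [cite: BalabanImbrieJaffe1988, (2.12) p.261] -/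
def curlyDloc {R : Type*} [Ring R] (Hloc Cloc Hsloc : ℕ → R) (k : ℕ) : R := BIJ85Sect4Statements.curlyD Hloc Cloc Hsloc k

/-- Operators given by kernels on finite index types: `(Kf)(b) = Σ_a K(b,a)f(a)`. [cite: BalabanImbrieJaffe1988, (2.13) p.261] -/
def applyK [Fintype α] (K : β → α → ℝ) (f : α → ℝ) (b : β) : ℝ := ∑ a, K b a * f a

/-- `‖f‖_∞` on a finite index type. [cite: BalabanImbrieJaffe1988, (2.13) p.261] -/
def supNorm [Fintype α] (f : α → ℝ) : ℝ := ⨆ a, |f a|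

/-- `dist(suppt f, b)` (infimum over the support; `0` for `f = 0`). [cite: BalabanImbrieJaffe1988, (2.13) p.261] -/
def suppDist (dist : α → β → ℝ) (f : α → ℝ) (b : β) : ℝ := ⨅ a : {a // f a ≠ 0}, dist a.1 b

/-- Operator decay `|(Kf)(b)| ≦ ce^{−c dist(suppt f, b)}‖f‖_∞`: **(2.13)** p. 261, verbatim *"|(𝒟_{k,loc}f)(b)| ≦ ce^{−c dist(suppt f,b)}
‖f‖_∞, (2.13) and similarly for derivatives of 𝒟_{k,loc} and Hölder derivatives of order less than 2"*; **(2.30)** p. 263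
*"|(G_{k,loc}(u)f)(x)| ≦ ce^{−c dist(suppt f,x)}‖f‖_∞, (2.30)"*. [cite: BalabanImbrieJaffe1988, (2.13) p.261] -/
def OpDecay [Fintype α] (dist : α → β → ℝ) (K : β → α → ℝ) (c : ℝ) : Prop :=
  ∀ f b, |applyK K f b| ≤ c * Real.exp (-c * suppDist dist f b) * supNorm f

/-- **(2.31)** p. 263 [PDF 7], verbatim: *"|(G_{k,loc}(u)f − G_k(Ω,u)f)(x)| ≦ e^{−cr(e_k)}e^{−c dist(suppt f,x)}‖f‖_∞, (2.31) for
dist(x, Ω^c) ≧ O(r(e_k))"* — the region condition as a hypothesis `Far x`. [cite: BalabanImbrieJaffe1988, (2.31) p.263] -/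
def OpClose231 [Fintype α] (dist : α → α → ℝ) (Far : α → Prop) (Gloc G : α → α → ℝ) (c rek : ℝ) : Prop :=
  ∀ f x, Far x → |applyK Gloc f x - applyK G f x| ≤ Real.exp (-c * rek) * Real.exp (-c * suppDist dist f x) * supNorm f

/-- **(2.15)** p. 261 [PDF 5], verbatim: *"Recall from [2] that σ_k = Q^e_k(I − ∂G_{k,Ax}∂*)Q^{e*}_k = Q^e_k(I − ∂𝒟_k∂*)Q^{e*}_k, (2.15)
the second equality following from the change of gauge, (I.5.2.6)"* — the operator expression, in a ring (`d` = ∂, `ds` = ∂*).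
[cite: BalabanImbrieJaffe1988, (2.15) p.261] -/
def sigmaOp {R : Type*} [Ring R] (Qe Qes d ds G : R) : R := Qe * (1 - d * G * ds) * Qes

/-- **(2.15)**, the asserted equality of the two expressions (via G_{k,Ax} and via 𝒟_k). [cite: BalabanImbrieJaffe1988, (2.15) p.261] -/
def Eq215 {R : Type*} [Ring R] (Qe Qes d ds GAx Dk : R) : Prop := sigmaOp Qe Qes d ds GAx = sigmaOp Qe Qes d ds Dk

/-- **(2.17)** p. 262 [PDF 6], verbatim: *"we shall only encounter situations where f^{(k)}(p₂) = (∂A)(p₂) for p₂ near p₁. Then we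
prove that (σ_kf^{(k)})(p₁) ≦ ‖f^{(k)}‖_∞ (2.17)"* — the hypothesis as an abstract predicate `Near p₁ f`.
[cite: BalabanImbrieJaffe1988, (2.17) p.262] -/
def Ineq217 [Fintype α] (σ : α → α → ℝ) (Near : α → (α → ℝ) → Prop) : Prop :=
  ∀ f p₁, Near p₁ f → applyK σ f p₁ ≤ supNorm f

/-- **(2.19)** p. 262 [PDF 6], verbatim: *"so that (2.16), (2.17) hold for σ_{k,loc}, and σ_{k,loc} ≧ c > 0 (2.19) as well"* — as a
quadratic-form lower bound. [cite: BalabanImbrieJaffe1988, (2.19) p.262] -/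
def Ineq219 [Fintype α] (σloc : α → α → ℝ) (c : ℝ) : Prop :=
  0 < c ∧ ∀ f : α → ℝ, c * ∑ p, f p ^ 2 ≤ ∑ p, f p * applyK σloc f p

/-- **(2.20)** p. 262 [PDF 6], verbatim: *"Another important kernel is the one generating the gauge transformation:
(Q^{s*}_k − 𝒟_k∂*Q^{e*}_k∂)A = H_kA + ∂C_kA. (2.20)"* — as an operator identity. [cite: BalabanImbrieJaffe1988, (2.20) p.262] -/
def Eq220 {R : Type*} [Ring R] (Qsst Dk ds Qest d Hk Ck : R) : Prop := Qsst - Dk * ds * Qest * d = Hk + d * Ck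

/-- **(2.21)** p. 262 [PDF 6], verbatim: *"The kernel C_k is constructed from the basic gauge transformation D_k which changes the
minimizer from axial to Landau gauge (I.5.1.1): H_{k,Ax}B = H_kB + ∂D_kB. (2.21)"* [cite: BalabanImbrieJaffe1988, (2.21) p.262] -/
def Eq221 {R : Type*} [Ring R] (HAx Hk d Dk : R) : Prop := HAx = Hk + d * Dk

/-- **(2.22)** p. 262 [PDF 6], verbatim: *"By changing gauge in each term in the hierarchical sum defining 𝒟_k and applying (I.5.3.1),
we obtain C_k = D_k + Σ_{j=0}^{k−1} D^{L^jη}_jC^{(j),L^jη}H^{*L^jη}_j∂*Q^{e*}_k∂. (2.22)"* — with `X = ∂*Q^{e*}_k∂`, the finite sum is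
`curlyD D C (j ↦ H*_jX)`. [cite: BalabanImbrieJaffe1988, (2.22) p.262] -/
def cK {R : Type*} [Ring R] (Dk : R) (D C Hs : ℕ → R) (X : R) (k : ℕ) : R :=
  Dk + BIJ85Sect4Statements.curlyD D C (fun j => Hs j * X) k

/-- **(2.34)** p. 263 [PDF 7], verbatim: *"We use G_{k,loc} to define a localized quadratic form for scalar fields, Δ_{k,loc}(u) = a_kI −
a_k²Q_k(u)G_{k,loc}(u)Q_k^*(u). (2.34) Here we have simply replaced G_k(Ω,u) with G_{k,loc} in the definition of Δ_k(Ω,u); see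
(I.4.6.4)."* — `BIJ85Sect4Statements.deltaScalar` at `G = G_{k,loc}(u)`. [cite: BalabanImbrieJaffe1988, (2.34) p.263] -/
def deltaLoc {R : Type*} [Ring R] [Algebra ℝ R] (ak : ℝ) (Q Gloc Qs : R) : R := BIJ85Sect4Statements.deltaScalar ak Q Gloc Qs

/-- **(2.35)** p. 263 [PDF 7], verbatim: *"|Δ_{k,loc}(u;x₁,x₂) − Δ_k(Ω,u;x₁,x₂)| ≦ e^{−cr(e_k)}e^{−c|x₁−x₂|} for dist({x₁,x₂},Ω^c) >
O(r(e_k)), (2.35)"* — region condition as a hypothesis `Far x₁ x₂`. [cite: BalabanImbrieJaffe1988, (2.35) p.263] -/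
def Close235 (dist : α → α → ℝ) (Far : α → α → Prop) (Δloc Δ : α → α → ℝ) (c rek : ℝ) : Prop :=
  ∀ x₁ x₂, Far x₁ x₂ → |Δloc x₁ x₂ - Δ x₁ x₂| ≤ Real.exp (-c * rek) * Real.exp (-c * dist x₁ x₂)

/-- **(2.39)–(2.40)** p. 264 [PDF 8], verbatim: *"C^{(k)}_Λ(Ω,u) = [(Δ_k(Ω,u) + aL^{−2}Q(u)*Q(u))|_Λ]^{−1}, (2.39) the single-scale
propagator for the scalar field in the k-th step. … We define C^{(k)}_Λ(u) = [(Δ_{k,loc}(u) + aL^{−2}Q(u)*Q(u)|_Λ]^{−1}. (2.40)"* — in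
the algebra of operators restricted to Λ: `C` is a two-sided inverse of `Δ + aL^{−2}Q*Q`. [cite: BalabanImbrieJaffe1988, (2.40) p.264] -/
def Eq240 {R : Type*} [Ring R] [Algebra ℝ R] (a L : ℝ) (Δ Qst Q C : R) : Prop :=
  C * (Δ + algebraMap ℝ R (a * L ^ (-(2 : ℤ))) * (Qst * Q)) = 1 ∧ (Δ + algebraMap ℝ R (a * L ^ (-(2 : ℤ))) * (Qst * Q)) * C = 1

/-- **(2.45)** p. 264 [PDF 8], verbatim: *"Then we define C^{(k)}_Λ(u) = C^{(k)}_{Λ,loc}(u) + Σ_X C^{(k)}_{Λ,X}(u), (2.45)"* (the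
resummed random walk expansion (2.42)–(2.44): `C_{Λ,loc} = Σ′_ω C_ω` over walks within ¼r(e_k), `C_{Λ,X} = Σ^X_ω C_ω` over walks
filling the connected union X of r(e_k)-cubes; also **(2.49)** p. 265 for the gauge field, `C^{(k)}_Λ = C^{(k)}_{Λ,loc} + Σ_X C^{(k)}_{Λ,X}`).
[cite: BalabanImbrieJaffe1988, (2.45) p.264] -/
def Eq245 {ξ : Type*} [Fintype ξ] (C Cloc : α → α → ℝ) (CX : ξ → α → α → ℝ) : Prop :=
  ∀ x₁ x₂, C x₁ x₂ = Cloc x₁ x₂ + ∑ X, CX X x₁ x₂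

/-- **(2.46)** p. 264 [PDF 8], verbatim: *"The operator C^{(k)}_{Λ,X}(u) depends only on u in X. It vanishes unless both arguments are
in X, and is estimated as follows: |C^{(k)}_{Λ,X}(u;x₁,x₂)| ≦ e^{−cr(e_k)|X|}. (2.46) Here and elsewhere, |X| refers to the number of
r(e_k)-cubes in X, not the volume of X."* [cite: BalabanImbrieJaffe1988, (2.46) p.264] -/
def Ineq246 {ξ : Type*} (ncubes : ξ → ℕ) (mem : α → ξ → Prop) (CX : ξ → α → α → ℝ) (c rek : ℝ) : Prop :=
  (∀ X x₁ x₂, ¬ (mem x₁ X ∧ mem x₂ X) → CX X x₁ x₂ = 0) ∧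
    ∀ X x₁ x₂, |CX X x₁ x₂| ≤ Real.exp (-c * rek * ncubes X)

/-! ## (2.32) smoothness and (2.38) the lower bound, on the tori of `Balaban1983to89.Setup` -/

open Literature.MathematicalPhysics.QuantumFieldTheory.Balaban1983to89

variable {P : Params} {j : ℕ}

/-- **(2.32)** p. 263 [PDF 7], verbatim: *"We assume that u is smooth in the □_α's entering the sum in (2.27) … This means that in a
neighborhood of each □_α there exists an A, λ such that u = exp[ie_kη(A + ∂λ)] with |∂A|, |∂*A| ≦ O(p(e_k)). (2.32)"* — on the
η-lattice torus of `Setup` (sites `X`, bonds `B`, plaquettes `Pl` of the neighbourhood), `∂λ` = `LatticeFieldCalculus.grad η⁻¹`,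
`∂A` = `curl η⁻¹` (plaquettes), `∂*A` = `diverg η⁻¹` (sites), the `O(·)` constant explicit. [cite: BalabanImbrieJaffe1988, (2.32) p.263] -/
def SmoothOn (ek η C pek : ℝ) (X : Finset (Balaban1983to89.Site P j)) (B : Finset (PBond P j)) (Pl : Finset (Plaq P j))
    (u : PBond P j → ℂ) : Prop :=
  ∃ (A : Balaban1983to89.VecField P j ℝ) (lam : SiteField P j ℝ),
    (∀ b ∈ B, u b = Complex.exp (Complex.I * (ek * η * (A b + LatticeFieldCalculus.grad η⁻¹ lam b) : ℝ))) ∧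
    (∀ p ∈ Pl, |LatticeFieldCalculus.curl η⁻¹ A p| ≤ C * pek) ∧ ∀ x ∈ X, |LatticeFieldCalculus.diverg η⁻¹ A x| ≤ C * pek

/-- **(2.38)** p. 264 [PDF 8], verbatim: *"Finally, in view of (2.35), the lower bound (I.7.3.2) applies to Δ_{k,loc}(u) as well. Let φ be
supported in a region having an r(e_k) neighborhood where u is smooth. Then ⟨φ, Δ_{k,loc}(u)φ⟩ ≧ c Σ_{b∈T₁^{(k)*}} |u(⟨b₋,b₊⟩)φ(b₊) −
φ(b₋)|² − ce_k²p(e_k)² Σ_{x∈T₁^{(k)}} |φ(x)|². (2.38)"* — the form `⟨φ, Δ_{k,loc}(u)φ⟩` and the support hypothesis as data.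
[cite: BalabanImbrieJaffe1988, (2.38) p.264] -/
def Ineq238 (c ek pek : ℝ) (form : (Balaban1983to89.Site P j → ℂ) → ℝ) (Adm : (Balaban1983to89.Site P j → ℂ) → Prop)
    (u : PBond P j → ℂ) : Prop :=
  ∀ φ, Adm φ → c * (∑ b : PBond P j, ‖u b * φ b.tgt - φ b.src‖ ^ 2) -
    c * ek ^ 2 * pek ^ 2 * (∑ x : Balaban1983to89.Site P j, ‖φ x‖ ^ 2) ≤ form φ

end

end Literature.MathematicalPhysics.QuantumFieldTheory.BalabanImbrieJaffe1984to88.BIJ88Sect2Statements
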